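import Literature.Analysis.FluidPDE.BesovBlowupCriteriaGKPClass
import Literature.Analysis.FluidPDE.NSCriticalClosureBesovGKPClass
import HarnessLib

/-!
# Corollaries of the faithful Besov blow-up criteria (GKP 2016, Thm. 1 / Albritton 2018, Thm. 1.1)

Analysis/FluidPDE proof file (theorems only: no definition, no named fact, no statement changed)
recording how the named facts `gkp_besov_blowup_pathSpace` and `albritton_besov_blowup_pathSpace`
(`BesovBlowupCriteriaGKPClass.lean`) feed the tree:

* `gkp_besov_blowup_pathSpace_of_albritton` — Albritton's limit form implies GKP's `limsup` form
  (`Tendsto.limsup_eq` along the non-trivial filter `𝓝[<] T`).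
* `gkp_besov_blowup_pathSpace.hasSmoothExtensionPast`,
  `albritton_besov_blowup_pathSpace.hasSmoothExtensionPast` — either fact yields the continuation
  criterion `hasSmoothExtensionPast_of_eHomBesovNorm_bounded` (`NSCriticalClosure.lean`), by the
  assembly theorems of `NSCriticalClosureBesovGKPClass.lean` whose hypotheses the facts ARE.

## References

* I. Gallagher, G. Koch, F. Planchon, Comm. Math. Phys. 343 (2016) = arXiv:1407.4156, Thm. 1.
  [`GKP2016`]
* D. Albritton, Anal. PDE 11 (2018) = arXiv:1612.04439, Thm. 1.1. [`Albritton2018`]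
-/

noncomputable section

open MeasureTheory Set Filter
open _root_.Topology
open scoped SchwartzMap ENNReal NNReal

namespace Literature.Analysis.FluidPDE

/-- Albritton 2018, Thm. 1.1 (limit form) implies GKP 2016, Thm. 1 (`limsup` form): a function
tending to `∞` along `𝓝[<] T` has `limsup = ∞` there. [cite: Albritton2018, Thm. 1.1 (discussion after it: "replaces the limsup condition in Gallagher–Koch–Planchon")] -/
theorem gkp_besov_blowup_pathSpace_of_albritton (h : albritton_besov_blowup_pathSpace) :
    gkp_besov_blowup_pathSpace :=
  fun _ hν _ _ _ hp₃ hp hq₃ hq _ hT _ _ hmax => (h hν hp₃ hp hq₃ hq hT hmax).limsup_eq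

/-- GKP 2016, Thm. 1 (faithful form) yields the critical Besov continuation criterion for
classical Leray–Hopf solutions, `hasSmoothExtensionPast_of_eHomBesovNorm_bounded`.
[cite: GKP2016, Thm. 1] -/
theorem gkp_besov_blowup_pathSpace.hasSmoothExtensionPast (h : gkp_besov_blowup_pathSpace) :
    hasSmoothExtensionPast_of_eHomBesovNorm_bounded :=
  hasSmoothExtensionPast_of_eHomBesovNorm_bounded_of_gkp_besov_blowup_pathSpace h

/-- Albritton 2018, Thm. 1.1 (faithful form) yields the critical Besov continuation criterion
`hasSmoothExtensionPast_of_eHomBesovNorm_bounded`. [cite: Albritton2018, Thm. 1.1] -/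
theorem albritton_besov_blowup_pathSpace.hasSmoothExtensionPast
    (h : albritton_besov_blowup_pathSpace) : hasSmoothExtensionPast_of_eHomBesovNorm_bounded :=
  hasSmoothExtensionPast_of_eHomBesovNorm_bounded_of_albritton_besov_blowup_pathSpace h

end Literature.Analysis.FluidPDE

end
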